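import Literature.NumberTheory.Automorphic.CMTorusRegularAEPrelims
import HarnessLib

/-!
# Non-regular elements of the diagonal torus of `U(Φ₃)(L⁺_v)` ∕ `U(Φ₂)(L⁺_v)` are Haar-null
# (Steinhaus; Rogawski 1990 §4.9, §12.5 «the regular set has full measure»; Harish-Chandra 1970)

Topic `NumberTheory/Automorphic`; namespace `Literature.NumberTheory.Automorphic.UnitaryGroup`.  THEOREMS ONLY (no definition, no instance, no notation, no
named fact, no `sorry`).  Cell `pub/hodgecm-mathlib`, line «CMCharIdentityTest» (F0P3b `Cruxes/H413/Lines/F0_P3b_CMCharIdentityTestPaydown.lean` ED. 11), desk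
F0P3b-plan (g12) FORWARD DEAL 2026-09-01T07:31:16Z S-lemma **(L1)** of the (N-492) road [Rogawski1990 Lemma 4.9.2]: S1 ★
`exists_smoothTrace_cmPrincipalSeries_eq_integral_torus` (p842217) integrates over ALL of `T`, while the torus descent (S0 ∕ ★
`lintegral_descConj_torusU_cmLocal_regular_eq_mul_lintegral_prod`, ★ `…_two_regular_…`) holds at `T`-REGULAR `t = diag(d)` only (`d₀⁻¹d₁ − 1`, `d₀⁻¹d₂ − 1`
units of `∏_{w ∣ v} L_w`); here the complement is shown `μ_T`-null for EVERY Haar measure `μ_T` on the torus, so the two glue by `ae` congruence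
(`MeasureTheory.integral_congr_ae`).
* **`ae_isUnit_torusRatio_sub_one_three`**: for every Haar `μ_T` on `T₃ = (cmBorelTriple L 3 v).M`, `μ_T`-a.e. `t` has `d₀⁻¹d₁ − 1` and `d₀⁻¹d₂ − 1` units
  (`dᵢ = torusEntry i t`, ★ `torusEntry_eq_of_glDiagonal_eq` converts to the `(hd, ha, hb)` binders of the descent);
* **`ae_isUnit_torusRatio_sub_one_two`**: the same on `T₂ = (cmBorelTriple L 2 v).M` for `d₀⁻¹d₁ − 1` (binder `hb` of the `N = 2` descent).
Proof: a non-unit of `∏_w L_w` has a zero component (Mathlib `Pi.isUnit_iff`), so the exceptional set is the finite union over `w ∣ v` of the walls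
`{(d₀⁻¹dᵢ)_w = 1}` — kernels of continuous homomorphisms, closed subgroups of `T`; each is avoided eventually by the sequence `d(U_k, 1, U_k⁻¹) → 1` (resp.
`diag(U_k, U_k⁻¹)`; ★ `exists_units_tendsto_one_conjLocal_eq`: ratios `U_k⁻¹`, `U_k⁻²`), hence is not a neighbourhood of `1`, hence null (★
`measure_subgroup_eq_zero_of_tendsto`, Steinhaus).  Every finite place `v` (split or not).
HONEST LABEL: HC_CM is proved only modulo the printed citations (2 remaining named inputs hLiu418, h413) until rung 0 closes; this file pays no letter by itself.

## References
* [Rogawski1990] J. D. Rogawski, *Automorphic Representations of Unitary Groups in Three Variables* (1990), §1.10 p. 9, §4.9 p. 55, §12.5 p. 183.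
* [HarishChandra1970] Harish-Chandra, *Harmonic analysis on reductive p-adic groups*, LNM 162 (1970), §§3–5 (regular set of full measure).
* [Folland1995] G. B. Folland, *A Course in Abstract Harmonic Analysis* (1995), Prop. 2.4 (Steinhaus).
-/

set_option autoImplicit false

noncomputable section

open NumberField IsDedekindDomain MeasureTheory MeasureTheory.Measure Topology Filter
open scoped MatrixGroups

namespace Literature.NumberTheory.Automorphic

namespace UnitaryGroup

/-! ## §4 Non-regular torus elements are Haar-null: `U(Φ₃)(L⁺_v)` and `U(Φ₂)(L⁺_v)` -/

section Three

variable (L : Type) [Field L] [NumberField L] [IsCMField L] (v : HeightOneSpectrum (𝓞 ↥(maximalRealSubfield L)))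

/-- The kernel `{t ∈ T | (d_i⁻¹ d_j)(t)_w = 1}` of a coordinate ratio read at a place `w ∣ v`, as a subgroup of the torus of `U(σ_v, J)(∏_w L_w)`.
(Private packaging of ★ `torusEntry`; used only in this section.) [cite: Rogawski1990, §1.10 p. 9] -/
private theorem exists_subgroup_ratio_apply_eq_one {N : ℕ} (J : Matrix (Fin N) (Fin N) (LocalRing L v)) (i j : Fin N) (w : PlacesOver L v) :
    ∃ H : Subgroup ↥(torusU (conjLocal L (IsCMField.complexConj L) v) J),
      (∀ t, t ∈ H ↔ (((torusEntry (conjLocal L (IsCMField.complexConj L) v) J i t)⁻¹ *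
        torusEntry (conjLocal L (IsCMField.complexConj L) v) J j t : (LocalRing L v)ˣ) : LocalRing L v) w = 1) ∧
      IsClosed (H : Set ↥(torusU (conjLocal L (IsCMField.complexConj L) v) J)) := by
  let φ : ↥(torusU (conjLocal L (IsCMField.complexConj L) v) J) →* w.1.adicCompletion L :=
    (Pi.evalMonoidHom (fun w' : PlacesOver L v => w'.1.adicCompletion L) w).comp
      ((Units.coeHom (LocalRing L v)).comp
        ((torusEntry (conjLocal L (IsCMField.complexConj L) v) J i)⁻¹ * torusEntry (conjLocal L (IsCMField.complexConj L) v) J j))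
  have hφ : ∀ t, φ t = (((torusEntry (conjLocal L (IsCMField.complexConj L) v) J i t)⁻¹ *
      torusEntry (conjLocal L (IsCMField.complexConj L) v) J j t : (LocalRing L v)ˣ) : LocalRing L v) w := fun _ => rfl
  refine ⟨φ.ker, fun t => by rw [MonoidHom.mem_ker, hφ], ?_⟩
  have hc : Continuous φ := by
    have : (φ : _ → w.1.adicCompletion L) = fun t => (((torusEntry (conjLocal L (IsCMField.complexConj L) v) J i t)⁻¹ *
        torusEntry (conjLocal L (IsCMField.complexConj L) v) J j t : (LocalRing L v)ˣ) : LocalRing L v) w := funext hφ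
    rw [this]
    exact (continuous_apply w).comp (continuous_coe_torusEntry_inv_mul (conjLocal L (IsCMField.complexConj L) v) J i j)
  have hset : ((φ.ker : Subgroup _) : Set ↥(torusU (conjLocal L (IsCMField.complexConj L) v) J)) = φ ⁻¹' {1} := by
    ext t; simp [MonoidHom.mem_ker]
  rw [hset]
  exact isClosed_singleton.preimage hc


set_option maxHeartbeats 800000 in
/-- **Non-regular elements of the torus `T₃ = (cmBorelTriple L 3 v).M` of `U(Φ₃)(L⁺_v)` are Haar-null**: for every Haar measure `μ_T` on `T₃`, `μ_T`-almost every
`t = d(d₀, d₁, d₂)` (`dᵢ = torusEntry i t`) has `d₀⁻¹d₁ − 1` and `d₀⁻¹d₂ − 1` units of `∏_{w ∣ v} L_w` — the regularity binders `ha`, `hb` of ★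
`lintegral_descConj_torusU_cmLocal_regular_eq_mul_lintegral_prod` ∕ ★ `lintegral_conj_unipotentU_cmLocal_eq_mul_lintegral_mul` hold off a `μ_T`-null set.
[cite: Rogawski1990, §4.9 p. 55; §12.5 p. 183] [cite: HarishChandra1970, §3] -/
theorem ae_isUnit_torusRatio_sub_one_three
    [MeasurableSpace ↥(unitaryGroupOfForm (conjLocal L (IsCMField.complexConj L) v) (cmLocalForm L 3 v))]
    [BorelSpace ↥(unitaryGroupOfForm (conjLocal L (IsCMField.complexConj L) v) (cmLocalForm L 3 v))]
    (μT : Measure ↥(cmBorelTriple L 3 v).M) [μT.IsHaarMeasure] :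
    ∀ᵐ t ∂μT,
      IsUnit ((((torusEntry (conjLocal L (IsCMField.complexConj L) v) (cmLocalForm L 3 v) 0 t)⁻¹ *
          torusEntry (conjLocal L (IsCMField.complexConj L) v) (cmLocalForm L 3 v) 1 t : (LocalRing L v)ˣ) : LocalRing L v) - 1) ∧
      IsUnit ((((torusEntry (conjLocal L (IsCMField.complexConj L) v) (cmLocalForm L 3 v) 0 t)⁻¹ *
          torusEntry (conjLocal L (IsCMField.complexConj L) v) (cmLocalForm L 3 v) 2 t : (LocalRing L v)ˣ) : LocalRing L v) - 1) := by
  -- instances on `G₃` and its torus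
  haveI : LocallyCompactSpace ↥(unitaryGroupOfForm (conjLocal L (IsCMField.complexConj L) v) (cmLocalForm L 3 v)) :=
    locallyCompactSpace_local (IsCMField.complexConj L) 3 _ v
  haveI : SecondCountableTopology ↥(unitaryGroupOfForm (conjLocal L (IsCMField.complexConj L) v) (cmLocalForm L 3 v)) :=
    secondCountableTopology_local (IsCMField.complexConj L) 3 _ v
  haveI : T2Space ↥(unitaryGroupOfForm (conjLocal L (IsCMField.complexConj L) v) (cmLocalForm L 3 v)) :=
    t2Space_cmDatum_local 3 L (Matrix.of fun i j : Fin 3 => if i.val + j.val + 1 = 3 then (1 : L) else 0) v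
  haveI : T1Space (LocalRing L v) := inferInstance
  have hTcl := isClosed_torusU_of_t1Space (conjLocal L (IsCMField.complexConj L) v) (cmLocalForm L 3 v)
  haveI : LocallyCompactSpace ↥(cmBorelTriple L 3 v).M := hTcl.isClosedEmbedding_subtypeVal.locallyCompactSpace
  haveI : SecondCountableTopology ↥(cmBorelTriple L 3 v).M := TopologicalSpace.Subtype.secondCountableTopology _
  haveI : SigmaCompactSpace ↥(cmBorelTriple L 3 v).M := sigmaCompactSpace_of_locallyCompact_secondCountable
  haveI : RegularSpace ↥(cmBorelTriple L 3 v).M := IsTopologicalGroup.regularSpace _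
  haveI : T2Space ↥(cmBorelTriple L 3 v).M := inferInstance
  haveI : T3Space ↥(cmBorelTriple L 3 v).M := @instT3Space _ _ inferInstance inferInstance
  haveI : TopologicalSpace.PseudoMetrizableSpace ↥(cmBorelTriple L 3 v).M :=
    (TopologicalSpace.metrizableSpace_of_t3_secondCountable ↥(cmBorelTriple L 3 v).M).toPseudoMetrizableSpace
  haveI : SigmaFinite μT := inferInstance
  haveI : μT.InnerRegular := Measure.instInnerRegularOfPseudoMetrizableSpaceOfSigmaCompactSpaceOfBorelSpaceOfSigmaFinite μT
  -- the sequence `t_k = d(U_k, 1, U_k⁻¹) → 1`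
  obtain ⟨U, hσU, hU1, hUi1, hUne, hUsq⟩ := exists_units_tendsto_one_conjLocal_eq L v
  have hσUi : ∀ k, conjLocal L (IsCMField.complexConj L) v (((U k)⁻¹ : (LocalRing L v)ˣ) : LocalRing L v) = (((U k)⁻¹ : (LocalRing L v)ˣ) : LocalRing L v) :=
    fun k => Units.eq_inv_of_mul_eq_one_left (by rw [← hσU k, ← map_mul, Units.mul_inv, map_one])
  let d : ℕ → Fin 3 → (LocalRing L v)ˣ := fun k => ![U k, 1, (U k)⁻¹]
  have hdmem : ∀ k, glDiagonal 3 (LocalRing L v) (d k) ∈ unitaryGroupOfForm (conjLocal L (IsCMField.complexConj L) v) (cmLocalForm L 3 v) := by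
    intro k
    rw [cmLocalForm_eq_over, glDiagonal_mem_unitaryGroupOfForm_antidiagonal_iff]
    intro i
    fin_cases i
    · show conjLocal L (IsCMField.complexConj L) v (((U k)⁻¹ : (LocalRing L v)ˣ) : LocalRing L v) * (U k : LocalRing L v) = 1
      rw [hσUi, Units.inv_mul]
    · show conjLocal L (IsCMField.complexConj L) v ((1 : (LocalRing L v)ˣ) : LocalRing L v) * ((1 : (LocalRing L v)ˣ) : LocalRing L v) = 1
      rw [Units.val_one, map_one, mul_one]
    · show conjLocal L (IsCMField.complexConj L) v (U k : LocalRing L v) * (((U k)⁻¹ : (LocalRing L v)ˣ) : LocalRing L v) = 1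
      rw [hσU, Units.mul_inv]
  let tk : ℕ → ↥(cmBorelTriple L 3 v).M := fun k => ⟨⟨glDiagonal 3 (LocalRing L v) (d k), hdmem k⟩, ⟨d k, rfl⟩⟩
  have hentry : ∀ k i, torusEntry (conjLocal L (IsCMField.complexConj L) v) (cmLocalForm L 3 v) i (tk k) = d k i :=
    fun k i => torusEntry_eq_of_glDiagonal_eq _ _ i (tk k) (d k) rfl
  have h1 : (1 : Matrix (Fin 3) (Fin 3) (LocalRing L v)) = Matrix.diagonal (fun _ => (1 : LocalRing L v)) := Matrix.diagonal_one.symm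
  have hA : Tendsto (fun k => (glDiagonal 3 (LocalRing L v) (d k)).val) atTop (𝓝 (1 : Matrix (Fin 3) (Fin 3) (LocalRing L v))) := by
    have hval : ∀ k, (glDiagonal 3 (LocalRing L v) (d k)).val = Matrix.diagonal (fun i => ((d k i : (LocalRing L v)ˣ) : LocalRing L v)) :=
      fun k => coe_glDiagonal 3 _ (d k)
    simp only [hval]
    rw [h1]
    refine ((continuous_id.matrix_diagonal).tendsto (fun _ : Fin 3 => (1 : LocalRing L v))).comp (tendsto_pi_nhds.2 fun i => ?_)
    fin_cases i
    · exact hU1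
    · exact tendsto_const_nhds
    · exact hUi1
  have hB : Tendsto (fun k => ((glDiagonal 3 (LocalRing L v) (d k))⁻¹).val) atTop (𝓝 (1 : Matrix (Fin 3) (Fin 3) (LocalRing L v))) := by
    have hval : ∀ k, ((glDiagonal 3 (LocalRing L v) (d k))⁻¹).val = Matrix.diagonal (fun i => (((d k i)⁻¹ : (LocalRing L v)ˣ) : LocalRing L v)) :=
      fun k => by rw [← map_inv]; exact coe_glDiagonal 3 _ (d k)⁻¹
    simp only [hval]
    rw [h1]
    refine ((continuous_id.matrix_diagonal).tendsto (fun _ : Fin 3 => (1 : LocalRing L v))).comp (tendsto_pi_nhds.2 fun i => ?_)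
    fin_cases i
    · exact hUi1
    · show Tendsto (fun k => (((1 : (LocalRing L v)ˣ)⁻¹ : (LocalRing L v)ˣ) : LocalRing L v)) atTop (𝓝 1)
      rw [inv_one, Units.val_one]; exact tendsto_const_nhds
    · show Tendsto (fun k => ((((U k)⁻¹)⁻¹ : (LocalRing L v)ˣ) : LocalRing L v)) atTop (𝓝 1)
      simp only [inv_inv]; exact hU1
  have htend : Tendsto tk atTop (𝓝 1) := by
    rw [Topology.IsInducing.subtypeVal.tendsto_nhds_iff, Topology.IsInducing.subtypeVal.tendsto_nhds_iff,
      Units.isInducing_embedProduct.tendsto_nhds_iff]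
    have hone : Units.embedProduct (Matrix (Fin 3) (Fin 3) (LocalRing L v))
        ((((1 : ↥(cmBorelTriple L 3 v).M) : ↥(unitaryGroupOfForm (conjLocal L (IsCMField.complexConj L) v) (cmLocalForm L 3 v))) :
          GL (Fin 3) (LocalRing L v))) = ((1 : Matrix (Fin 3) (Fin 3) (LocalRing L v)), MulOpposite.op 1) := by
      rw [OneMemClass.coe_one, OneMemClass.coe_one, Units.embedProduct_apply, inv_one, Units.val_one]
    rw [hone]
    exact Tendsto.congr (fun k => rfl) (hA.prodMk_nhds ((MulOpposite.continuous_op.tendsto _).comp hB))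
  -- each wall `{(d₀⁻¹ d_j)_w = 1}` (`j = 1, 2`) is a closed subgroup avoided by `t_k` eventually, hence null
  have hnull : ∀ (j : Fin 3), (j = 1 ∨ j = 2) → ∀ w : PlacesOver L v,
      μT {t | (((torusEntry (conjLocal L (IsCMField.complexConj L) v) (cmLocalForm L 3 v) 0 t)⁻¹ *
        torusEntry (conjLocal L (IsCMField.complexConj L) v) (cmLocalForm L 3 v) j t : (LocalRing L v)ˣ) : LocalRing L v) w = 1} = 0 := by
    intro j hj w
    obtain ⟨H, hH, hHcl⟩ := exists_subgroup_ratio_apply_eq_one L v (cmLocalForm L 3 v) 0 j w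
    have hset : {t : ↥(cmBorelTriple L 3 v).M | (((torusEntry (conjLocal L (IsCMField.complexConj L) v) (cmLocalForm L 3 v) 0 t)⁻¹ *
        torusEntry (conjLocal L (IsCMField.complexConj L) v) (cmLocalForm L 3 v) j t : (LocalRing L v)ˣ) : LocalRing L v) w = 1} = H := by
      ext t; exact (hH t).symm
    rw [hset]
    refine measure_subgroup_eq_zero_of_tendsto μT H hHcl.measurableSet htend (Filter.Eventually.frequently ?_)
    filter_upwards [hUsq] with k hk
    rw [hH, hentry, hentry]
    have hab : (U k : LocalRing L v) w * (((U k)⁻¹ : (LocalRing L v)ˣ) : LocalRing L v) w = 1 := by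
      have := congr_fun (Units.mul_inv (U k)) w
      rwa [Pi.mul_apply, Pi.one_apply] at this
    rcases hj with rfl | rfl
    · show ¬ ((((U k)⁻¹ * 1 : (LocalRing L v)ˣ) : LocalRing L v) w = 1)
      rw [mul_one]
      intro h
      apply hUne k w
      rw [h, mul_one] at hab
      exact hab
    · show ¬ ((((U k)⁻¹ * (U k)⁻¹ : (LocalRing L v)ˣ) : LocalRing L v) w = 1)
      rw [Units.val_mul, Pi.mul_apply]
      intro h
      apply hk w
      calc (U k : LocalRing L v) w * (U k : LocalRing L v) w
          = (U k : LocalRing L v) w * (U k : LocalRing L v) w *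
              ((((U k)⁻¹ : (LocalRing L v)ˣ) : LocalRing L v) w * (((U k)⁻¹ : (LocalRing L v)ˣ) : LocalRing L v) w) := by rw [h, mul_one]
        _ = ((U k : LocalRing L v) w * (((U k)⁻¹ : (LocalRing L v)ˣ) : LocalRing L v) w) *
              ((U k : LocalRing L v) w * (((U k)⁻¹ : (LocalRing L v)ˣ) : LocalRing L v) w) := by ring
        _ = 1 := by rw [hab, one_mul]
  -- a non-unit of `∏_w L_w` has a zero component
  have hwall : ∀ x : (LocalRing L v)ˣ, ¬ IsUnit ((x : LocalRing L v) - 1) → ∃ w : PlacesOver L v, (x : LocalRing L v) w = 1 := by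
    intro x hx
    by_contra hall
    exact hx (Pi.isUnit_iff.2 fun w => isUnit_iff_ne_zero.2 (sub_ne_zero.2 fun h => hall ⟨w, h⟩))
  rw [ae_iff]
  refine measure_mono_null (t := ⋃ w : PlacesOver L v,
    ({t | (((torusEntry (conjLocal L (IsCMField.complexConj L) v) (cmLocalForm L 3 v) 0 t)⁻¹ *
        torusEntry (conjLocal L (IsCMField.complexConj L) v) (cmLocalForm L 3 v) 1 t : (LocalRing L v)ˣ) : LocalRing L v) w = 1} ∪
     {t | (((torusEntry (conjLocal L (IsCMField.complexConj L) v) (cmLocalForm L 3 v) 0 t)⁻¹ *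
        torusEntry (conjLocal L (IsCMField.complexConj L) v) (cmLocalForm L 3 v) 2 t : (LocalRing L v)ˣ) : LocalRing L v) w = 1})) ?_ ?_
  · intro t ht
    rw [Set.mem_setOf_eq, not_and_or] at ht
    rw [Set.mem_iUnion]
    rcases ht with h | h
    · obtain ⟨w, hw⟩ := hwall _ h
      exact ⟨w, Or.inl hw⟩
    · obtain ⟨w, hw⟩ := hwall _ h
      exact ⟨w, Or.inr hw⟩
  · exact (measure_iUnion_null_iff.2 fun w => measure_union_null (hnull 1 (Or.inl rfl) w) (hnull 2 (Or.inr rfl) w))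

end Three

section Two

variable (L : Type) [Field L] [NumberField L] [IsCMField L] (v : HeightOneSpectrum (𝓞 ↥(maximalRealSubfield L)))


set_option maxHeartbeats 800000 in
/-- **Non-regular elements of the torus `T₂ = (cmBorelTriple L 2 v).M` of `U(Φ₂)(L⁺_v)` are Haar-null**: for every Haar measure `μ_T` on `T₂`, `μ_T`-almost every
`t = diag(d₀, d₁)` (`dᵢ = torusEntry i t`) has `d₀⁻¹d₁ − 1` a unit of `∏_{w ∣ v} L_w` — the regularity binder `hb` of ★
`lintegral_descConj_torusU_cmLocal_two_regular_eq_mul_lintegral_prod` holds off a `μ_T`-null set (curve `diag(U_k, U_k⁻¹)`, ratio `U_k⁻²`).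
[cite: Rogawski1990, §4.9 p. 55; §12.5 p. 183] [cite: HarishChandra1970, §3] -/
theorem ae_isUnit_torusRatio_sub_one_two
    [MeasurableSpace ↥(unitaryGroupOfForm (conjLocal L (IsCMField.complexConj L) v) (cmLocalForm L 2 v))]
    [BorelSpace ↥(unitaryGroupOfForm (conjLocal L (IsCMField.complexConj L) v) (cmLocalForm L 2 v))]
    (μT : Measure ↥(cmBorelTriple L 2 v).M) [μT.IsHaarMeasure] :
    ∀ᵐ t ∂μT,
      IsUnit ((((torusEntry (conjLocal L (IsCMField.complexConj L) v) (cmLocalForm L 2 v) 0 t)⁻¹ *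
          torusEntry (conjLocal L (IsCMField.complexConj L) v) (cmLocalForm L 2 v) 1 t : (LocalRing L v)ˣ) : LocalRing L v) - 1) := by
  -- instances on `G₂` and its torus
  haveI : LocallyCompactSpace ↥(unitaryGroupOfForm (conjLocal L (IsCMField.complexConj L) v) (cmLocalForm L 2 v)) :=
    locallyCompactSpace_local (IsCMField.complexConj L) 2 _ v
  haveI : SecondCountableTopology ↥(unitaryGroupOfForm (conjLocal L (IsCMField.complexConj L) v) (cmLocalForm L 2 v)) :=
    secondCountableTopology_local (IsCMField.complexConj L) 2 _ v
  haveI : T2Space ↥(unitaryGroupOfForm (conjLocal L (IsCMField.complexConj L) v) (cmLocalForm L 2 v)) :=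
    t2Space_cmDatum_local 2 L (Matrix.of fun i j : Fin 2 => if i.val + j.val + 1 = 2 then (1 : L) else 0) v
  haveI : T1Space (LocalRing L v) := inferInstance
  have hTcl := isClosed_torusU_of_t1Space (conjLocal L (IsCMField.complexConj L) v) (cmLocalForm L 2 v)
  haveI : LocallyCompactSpace ↥(cmBorelTriple L 2 v).M := hTcl.isClosedEmbedding_subtypeVal.locallyCompactSpace
  haveI : SecondCountableTopology ↥(cmBorelTriple L 2 v).M := TopologicalSpace.Subtype.secondCountableTopology _
  haveI : SigmaCompactSpace ↥(cmBorelTriple L 2 v).M := sigmaCompactSpace_of_locallyCompact_secondCountable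
  haveI : RegularSpace ↥(cmBorelTriple L 2 v).M := IsTopologicalGroup.regularSpace _
  haveI : T2Space ↥(cmBorelTriple L 2 v).M := inferInstance
  haveI : T3Space ↥(cmBorelTriple L 2 v).M := @instT3Space _ _ inferInstance inferInstance
  haveI : TopologicalSpace.PseudoMetrizableSpace ↥(cmBorelTriple L 2 v).M :=
    (TopologicalSpace.metrizableSpace_of_t3_secondCountable ↥(cmBorelTriple L 2 v).M).toPseudoMetrizableSpace
  haveI : SigmaFinite μT := inferInstance
  haveI : μT.InnerRegular := Measure.instInnerRegularOfPseudoMetrizableSpaceOfSigmaCompactSpaceOfBorelSpaceOfSigmaFinite μT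
  -- the sequence `t_k = diag(U_k, U_k⁻¹) → 1`
  obtain ⟨U, hσU, hU1, hUi1, -, hUsq⟩ := exists_units_tendsto_one_conjLocal_eq L v
  have hσUi : ∀ k, conjLocal L (IsCMField.complexConj L) v (((U k)⁻¹ : (LocalRing L v)ˣ) : LocalRing L v) = (((U k)⁻¹ : (LocalRing L v)ˣ) : LocalRing L v) :=
    fun k => Units.eq_inv_of_mul_eq_one_left (by rw [← hσU k, ← map_mul, Units.mul_inv, map_one])
  let d : ℕ → Fin 2 → (LocalRing L v)ˣ := fun k => ![U k, (U k)⁻¹]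
  have hdmem : ∀ k, glDiagonal 2 (LocalRing L v) (d k) ∈ unitaryGroupOfForm (conjLocal L (IsCMField.complexConj L) v) (cmLocalForm L 2 v) := by
    intro k
    rw [cmLocalForm_eq_over, glDiagonal_mem_unitaryGroupOfForm_antidiagonal_iff]
    intro i
    fin_cases i
    · show conjLocal L (IsCMField.complexConj L) v (((U k)⁻¹ : (LocalRing L v)ˣ) : LocalRing L v) * (U k : LocalRing L v) = 1
      rw [hσUi, Units.inv_mul]
    · show conjLocal L (IsCMField.complexConj L) v (U k : LocalRing L v) * (((U k)⁻¹ : (LocalRing L v)ˣ) : LocalRing L v) = 1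
      rw [hσU, Units.mul_inv]
  let tk : ℕ → ↥(cmBorelTriple L 2 v).M := fun k => ⟨⟨glDiagonal 2 (LocalRing L v) (d k), hdmem k⟩, ⟨d k, rfl⟩⟩
  have hentry : ∀ k i, torusEntry (conjLocal L (IsCMField.complexConj L) v) (cmLocalForm L 2 v) i (tk k) = d k i :=
    fun k i => torusEntry_eq_of_glDiagonal_eq _ _ i (tk k) (d k) rfl
  have h1 : (1 : Matrix (Fin 2) (Fin 2) (LocalRing L v)) = Matrix.diagonal (fun _ => (1 : LocalRing L v)) := Matrix.diagonal_one.symm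
  have hA : Tendsto (fun k => (glDiagonal 2 (LocalRing L v) (d k)).val) atTop (𝓝 (1 : Matrix (Fin 2) (Fin 2) (LocalRing L v))) := by
    have hval : ∀ k, (glDiagonal 2 (LocalRing L v) (d k)).val = Matrix.diagonal (fun i => ((d k i : (LocalRing L v)ˣ) : LocalRing L v)) :=
      fun k => coe_glDiagonal 2 _ (d k)
    simp only [hval]
    rw [h1]
    refine ((continuous_id.matrix_diagonal).tendsto (fun _ : Fin 2 => (1 : LocalRing L v))).comp (tendsto_pi_nhds.2 fun i => ?_)
    fin_cases i
    · exact hU1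
    · exact hUi1
  have hB : Tendsto (fun k => ((glDiagonal 2 (LocalRing L v) (d k))⁻¹).val) atTop (𝓝 (1 : Matrix (Fin 2) (Fin 2) (LocalRing L v))) := by
    have hval : ∀ k, ((glDiagonal 2 (LocalRing L v) (d k))⁻¹).val = Matrix.diagonal (fun i => (((d k i)⁻¹ : (LocalRing L v)ˣ) : LocalRing L v)) :=
      fun k => by rw [← map_inv]; exact coe_glDiagonal 2 _ (d k)⁻¹
    simp only [hval]
    rw [h1]
    refine ((continuous_id.matrix_diagonal).tendsto (fun _ : Fin 2 => (1 : LocalRing L v))).comp (tendsto_pi_nhds.2 fun i => ?_)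
    fin_cases i
    · exact hUi1
    · show Tendsto (fun k => ((((U k)⁻¹)⁻¹ : (LocalRing L v)ˣ) : LocalRing L v)) atTop (𝓝 1)
      simp only [inv_inv]; exact hU1
  have htend : Tendsto tk atTop (𝓝 1) := by
    rw [Topology.IsInducing.subtypeVal.tendsto_nhds_iff, Topology.IsInducing.subtypeVal.tendsto_nhds_iff,
      Units.isInducing_embedProduct.tendsto_nhds_iff]
    have hone : Units.embedProduct (Matrix (Fin 2) (Fin 2) (LocalRing L v))
        ((((1 : ↥(cmBorelTriple L 2 v).M) : ↥(unitaryGroupOfForm (conjLocal L (IsCMField.complexConj L) v) (cmLocalForm L 2 v))) :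
          GL (Fin 2) (LocalRing L v))) = ((1 : Matrix (Fin 2) (Fin 2) (LocalRing L v)), MulOpposite.op 1) := by
      rw [OneMemClass.coe_one, OneMemClass.coe_one, Units.embedProduct_apply, inv_one, Units.val_one]
    rw [hone]
    exact Tendsto.congr (fun k => rfl) (hA.prodMk_nhds ((MulOpposite.continuous_op.tendsto _).comp hB))
  -- each wall `{(d₀⁻¹ d₁)_w = 1}` is a closed subgroup avoided by `t_k` eventually, hence null
  have hnull : ∀ w : PlacesOver L v,
      μT {t | (((torusEntry (conjLocal L (IsCMField.complexConj L) v) (cmLocalForm L 2 v) 0 t)⁻¹ *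
        torusEntry (conjLocal L (IsCMField.complexConj L) v) (cmLocalForm L 2 v) 1 t : (LocalRing L v)ˣ) : LocalRing L v) w = 1} = 0 := by
    intro w
    obtain ⟨H, hH, hHcl⟩ := exists_subgroup_ratio_apply_eq_one L v (cmLocalForm L 2 v) 0 1 w
    have hset : {t : ↥(cmBorelTriple L 2 v).M | (((torusEntry (conjLocal L (IsCMField.complexConj L) v) (cmLocalForm L 2 v) 0 t)⁻¹ *
        torusEntry (conjLocal L (IsCMField.complexConj L) v) (cmLocalForm L 2 v) 1 t : (LocalRing L v)ˣ) : LocalRing L v) w = 1} = H := by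
      ext t; exact (hH t).symm
    rw [hset]
    refine measure_subgroup_eq_zero_of_tendsto μT H hHcl.measurableSet htend (Filter.Eventually.frequently ?_)
    filter_upwards [hUsq] with k hk
    rw [hH, hentry, hentry]
    have hab : (U k : LocalRing L v) w * (((U k)⁻¹ : (LocalRing L v)ˣ) : LocalRing L v) w = 1 := by
      have := congr_fun (Units.mul_inv (U k)) w
      rwa [Pi.mul_apply, Pi.one_apply] at this
    show ¬ ((((U k)⁻¹ * (U k)⁻¹ : (LocalRing L v)ˣ) : LocalRing L v) w = 1)
    rw [Units.val_mul, Pi.mul_apply]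
    intro h
    apply hk w
    calc (U k : LocalRing L v) w * (U k : LocalRing L v) w
        = (U k : LocalRing L v) w * (U k : LocalRing L v) w *
            ((((U k)⁻¹ : (LocalRing L v)ˣ) : LocalRing L v) w * (((U k)⁻¹ : (LocalRing L v)ˣ) : LocalRing L v) w) := by rw [h, mul_one]
      _ = ((U k : LocalRing L v) w * (((U k)⁻¹ : (LocalRing L v)ˣ) : LocalRing L v) w) *
            ((U k : LocalRing L v) w * (((U k)⁻¹ : (LocalRing L v)ˣ) : LocalRing L v) w) := by ring
      _ = 1 := by rw [hab, one_mul]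
  -- a non-unit of `∏_w L_w` has a zero component
  have hwall : ∀ x : (LocalRing L v)ˣ, ¬ IsUnit ((x : LocalRing L v) - 1) → ∃ w : PlacesOver L v, (x : LocalRing L v) w = 1 := by
    intro x hx
    by_contra hall
    exact hx (Pi.isUnit_iff.2 fun w => isUnit_iff_ne_zero.2 (sub_ne_zero.2 fun h => hall ⟨w, h⟩))
  rw [ae_iff]
  refine measure_mono_null (t := ⋃ w : PlacesOver L v,
    {t | (((torusEntry (conjLocal L (IsCMField.complexConj L) v) (cmLocalForm L 2 v) 0 t)⁻¹ *
        torusEntry (conjLocal L (IsCMField.complexConj L) v) (cmLocalForm L 2 v) 1 t : (LocalRing L v)ˣ) : LocalRing L v) w = 1}) ?_ ?_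
  · intro t ht
    rw [Set.mem_setOf_eq] at ht
    rw [Set.mem_iUnion]
    exact hwall _ ht
  · exact measure_iUnion_null_iff.2 fun w => hnull w

end Two

end UnitaryGroup

end Literature.NumberTheory.Automorphic

end
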